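import Literature.MathematicalPhysics.QuantumFieldTheory.King1986.MinimizerTwoSpacingDecay
import HarnessLib

/-!
# King 1986, Theorem 3.3 ∕ Prop. 3.8 (3.71) line 1 for the ACTUAL minimiser kernels, IN KING'S OWN BLOCK-DISTANCE
# CURRENCY: decay `e^{−δ₀|B(x) − z|_{T₁}}` in the unit-torus distance `tdistT` between the block of the fine point and
# the unit site — the DICTIONARY from the tower-label currency of `MinimizerTowerBridge` ∕ `MinimizerTwoSpacingDecay`

**Citation header (reproduction of PUBLISHED and PROVED work; seat `pub-ymgap-dag-n18-b` (g2) of the cell `pub-ymgap`,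
Track-A node N18 = NE5 whose PRINTED MODEL of record is King's Prop. 3.8 ∕ 3.9; eighth file of the seat's chain
`MinimizerAliasModes` → … → `MinimizerTwoSpacingDecay` → THIS FILE.  It answers the pin recorded twice on the cell's
bus: the outer-line binders of the (3.73) knit `BalabanUVNodesN18KingModelScales.ne5_of_threeFactorRates_lemma45` (seat
n18-a g3) and the dominance bridge of `BalabanUVNodesN15DefectKernelTower` (seat n15-a g2, referee pin «TOWER-DOMINANCE-
SLACK») read King's kernels with decay in the UNIT-TORUS distance `tdistT` of `King1986/UniformDecay`, whereas the
transported Theorem 3.3 (`minimiser_kernel_decay_labels`) and the printed shape `king_prop38_torus_printed` speak the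
tower's label currency `ε·T P 0 x z` on `Site P 0`.  This file converts one into the other, with the additive slack `2`
that makes the conversion sound (a fine point is within `1 − ε` of the corner of its block, on both sides).)**
C. King, *The U(1) Higgs model. I. The continuum limit*, Commun. Math. Phys. **102** (1986) 649–677 [King1986]:
Theorem 3.3 (3.7) p. 658 «|(G_k(Ω, A)f)(x)| ≤ C exp[−δ₀ dist(x, supp f)]‖f‖_∞», Prop. 3.7 (3.64) p. 663
«exp[−δ₀(L^jη)^{−1} dist(B^j(x), y)]» (decay measured from the BLOCK of the fine point to the unit site — exactly the
currency produced here), Prop. 3.8 (3.71) p. 664, p. 674 «combining our bounds with Theorem 3.3 we deduce (3.71)».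
T. Bałaban, *Regularity and decay of lattice Green's functions*, CMP **89** (1983) [Balaban1983RegularityDecay], Theorem
(1.10) p. 573 (the source of Theorem 3.3, certified on the torus by lit-balaban's `B4Thm110ZeroTorus.thm110_zero_torus`).

**What this file PROVES (kernel; 0 `def`).**
* §1 tower geometry: `blk_eq_proj` (B5's block map IS B1's `proj K K`), `T_blk_blk_le`
  (`L^K·|B(x) − B(z)|_{T^{(K)}} ≤ |x − z|_{T^{(0)}} + 2(L^K − 1)`), `T_blk_le_eps_mul`
  (`|B(x) − B(z)|_{T^{(K)}} ≤ ε|x − z|_{T^{(0)}} + 2` — the dominance WITH ADDITIVE SLACK asked for by the referee).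
* §2 `tdistT_toTorUnit`: the unit-site dictionary `toTorUnit` is an ISOMETRY `(T^{(K)}, T P K) → (Tor M, tdistT M)`.
* §3 **`minimiser_kernel_decay_blocks`** — Theorem 3.3 ∕ Prop. 3.7 for `ℋ_K = a_KG^η_KQ^*_K` in King's currency, NO label
  hypotheses: `δ₀, c₀ > 0` depending on `d, L, a, m²` only, and for every volume `(d, L, m, K)`, `K ≥ 1`, the unit torus
  `M_μ = 2L^m`, every spelling `N = L^K`, EVERY fine point `x ∈ Tor (fine N M)` and unit site `b ∈ Tor M`:
  `|ℋ_K(x, b)| ≤ a_K·c₀·e^{−δ₀·tdistT M (B(x)) b}`.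
* §4 **`king_prop38_torus_blocks`** — (3.71) line 1 in the same currency: `|ℋ_{K+n}(x′, b) − ℋ_K(x, b)| ≤
  √(2ac₀(C₁ + C₂)L^{−γK})·e^{−(δ₀∕2)·tdistT M (B(x)) b}` for all `x′` over `x`, all `b`, `n ≥ 1`, `0 ≤ γ ≤ 1`.
* §5 the read-out shapes of the consumers: `minimiser_row_decay` ∕ `minimiser_row_rate` (any smaller rate `κ`, column
  form by `tdistT_symm`).

**NOT COVERED.**  Unit tori other than Bałaban's `2L^m` (the decay input is certified for these volumes only); the
derivative ∕ Hölder lines of (3.71); `A ≠ 0`.  HONEST FRAMING: King's `A = 0` scalar MODEL of the NE5 mechanism —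
template literature on a finite torus; a change of currency of PROVED tree theorems, no new estimate; nothing about
Bałaban's covariant objects; nothing continuum ∕ mass-gap ∕ Clay; count-neutral for the cell's 27 nodes.
-/

noncomputable section

open Finset Real Matrix
open scoped BigOperators

namespace Literature.MathematicalPhysics.QuantumFieldTheory.King1986

open Literature.MathematicalPhysics.QuantumFieldTheory.Balaban1983to89 (Params)
open Literature.MathematicalPhysics.QuantumFieldTheory.Balaban1983to89.B5Prop11Plancherel
open Literature.MathematicalPhysics.QuantumFieldTheory.Balaban1983to89.B4TorusKernel.MultiPeriod (circAbs)
open Literature.MathematicalPhysics.QuantumFieldTheory.Balaban1983to89.B5Ineq137Torus (T blk toT Nv)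

namespace Torus

variable {d : ℕ}

/-! ## §1 Tower geometry: the block of a fine point is within `L^K − 1` of it, on both ends of a two-point distance -/

/-- B5's block map `T^{(0)} → T^{(K)}` (integer division of the labels by `L^K`) IS B1's `K`-fold block map `proj K K`
(both read B12 (0.3) ∕ B1 (1.20)). [cite: Balaban1982Higgs1, (1.20) p.607] -/
theorem blk_eq_proj (P : Params) (z : Balaban1983to89.Site P 0) : blk P P.K z = Balaban1983to89.Site.proj P.K P.K z := rfl

/-- **Block distances are dominated by point distances, with slack**: for fine points `x, z ∈ T^{(0)}`,
`L^K·|B(x) − B(z)|_{T^{(K)}} ≤ |x − z|_{T^{(0)}} + 2(L^K − 1)` (sup torus distances in lattice units; the corner of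
the `L^K`-block of a fine point is within `L^K − 1` of it, `B5Ineq137Torus.T_blk_le`, and corner distances are
`L^K` times the unit-lattice distances, `T_fine_fine`). [cite: King1986, Prop. 3.7 (3.64) p.663] -/
theorem T_blk_blk_le (P : Params) (x z : Balaban1983to89.Site P 0) :
    (P.L : ℝ) ^ P.K * T P P.K (blk P P.K x) (blk P P.K z) ≤ T P 0 x z + 2 * ((P.L : ℝ) ^ P.K - 1) := by
  have hK : P.K ≤ P.m + P.K := Nat.le_add_left _ _
  rw [← Balaban1983to89.B5Ineq137Torus.T_fine_fine P hK]
  have h1 := Balaban1983to89.B5Ineq137Torus.T_blk_le P hK x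
  have h2 := Balaban1983to89.B5Ineq137Torus.T_blk_le P hK z
  have t1 := Balaban1983to89.B5Ineq137Torus.T_triangle P 0
    (Balaban1983to89.B5Ineq137Torus.fine P P.K (blk P P.K x)) x
    (Balaban1983to89.B5Ineq137Torus.fine P P.K (blk P P.K z))
  have t2 := Balaban1983to89.B5Ineq137Torus.T_triangle P 0 x z
    (Balaban1983to89.B5Ineq137Torus.fine P P.K (blk P P.K z))
  rw [Balaban1983to89.B5Ineq137Torus.T_symm P 0 _ x] at t1
  linarith

/-- **The dominance with additive slack**: `|B(x) − B(z)|_{T^{(K)}} ≤ ε·|x − z|_{T^{(0)}} + 2` (`ε = L^{−K}`; physical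
distance of the fine points versus unit-lattice distance of their blocks). [cite: King1986, Prop. 3.7 (3.64) p.663] -/
theorem T_blk_le_eps_mul (P : Params) (x z : Balaban1983to89.Site P 0) :
    T P P.K (blk P P.K x) (blk P P.K z) ≤ P.eps * T P 0 x z + 2 := by
  have hLK : (0 : ℝ) < (P.L : ℝ) ^ P.K := pow_pos (Nat.cast_pos.mpr P.L_pos) _
  have h := T_blk_blk_le P x z
  have heps : P.eps = ((P.L : ℝ) ^ P.K)⁻¹ := by rw [Params.eps, inv_pow]
  have hT0 := Balaban1983to89.B5Ineq137Torus.T_nonneg P 0 x z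
  have hdiv : T P P.K (blk P P.K x) (blk P P.K z) ≤ (T P 0 x z + 2 * (P.L : ℝ) ^ P.K) / (P.L : ℝ) ^ P.K := by
    rw [le_div_iff₀ hLK]; linarith
  calc T P P.K (blk P P.K x) (blk P P.K z) ≤ (T P 0 x z + 2 * (P.L : ℝ) ^ P.K) / (P.L : ℝ) ^ P.K := hdiv
    _ = P.eps * T P 0 x z + 2 := by rw [heps]; field_simp

/-! ## §2 The unit-site dictionary is an isometry `(T^{(K)}, T) ≅ (Tor M, tdistT)` -/

/-- **`toTorUnit` preserves the sup torus distance**: `tdistT M (toTorUnit p) (toTorUnit b) = |p − b|_{T^{(K)}}` (both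
are `max_μ dist(p_μ − b_μ, M_μℤ)` on the same labels, `M_μ = sitesPerDir K = 2L^m` — the two typings of B12's unit
torus `T^{(K)}_1` (0.1)). [cite: Balaban1987RG1, (0.1) p.251] -/
theorem tdistT_toTorUnit (P : Params) (M : Fin P.d → ℕ) [∀ μ, NeZero (M μ)] (hMK : ∀ μ, M μ = P.sitesPerDir P.K)
    (p b : Balaban1983to89.Site P P.K) :
    tdistT M (toTorUnit P M hMK p) (toTorUnit P M hMK b) = T P P.K p b := by
  have hcc : ∀ μ, Balaban1983to89.B4Sect5Torus.ccoord M (toSite M (toTorUnit P M hMK p))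
        (toSite M (toTorUnit P M hMK b)) μ
      = Balaban1983to89.B4Sect5Torus.ccoord (Nv P P.K) (toT p) (toT b) μ := by
    intro μ
    show (circAbs (M μ) ((((toTorUnit P M hMK p μ).val : ℕ) : ℤ) - (((toTorUnit P M hMK b μ).val : ℕ) : ℤ))).toNat
      = (circAbs (P.sitesPerDir P.K) ((((p μ).val : ℕ) : ℤ) - (((b μ).val : ℕ) : ℤ))).toNat
    rw [val_toTorUnit, val_toTorUnit, hMK μ]
  unfold tdistT Balaban1983to89.B5Ineq137Torus.T Balaban1983to89.B4Sect5Torus.tdist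
  rw [Finset.sup_congr rfl (fun μ _ => hcc μ)]

/-- The block of a fine point, read through the dictionaries: `tdistT M (B(toTor x)) (toTorUnit b) = |B(x) − b|_{T^{(K)}}`.
[cite: Balaban1982Higgs1, (1.20) p.607] -/
theorem tdistT_blockOf_toTor (P : Params) (M : Fin P.d → ℕ) [∀ μ, NeZero (M μ)]
    (hMK : ∀ μ, M μ = P.sitesPerDir P.K) (x : Balaban1983to89.Site P 0) (b : Balaban1983to89.Site P P.K) :
    tdistT M (blockOf (P.L ^ P.K) M (toTor P M hMK x)) (toTorUnit P M hMK b) = T P P.K (blk P P.K x) b := by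
  rw [blockOf_toTor, tdistT_toTorUnit, blk_eq_proj]

/-! ## §3 Theorem 3.3 ∕ Prop. 3.7 for `ℋ_K` in King's block-distance currency — no label hypotheses -/

/-- **UNIFORM EXPONENTIAL DECAY OF KING'S MINIMISER KERNEL IN THE UNIT-TORUS DISTANCE FROM THE BLOCK OF THE FINE POINT
(King's Theorem 3.3 ∕ Prop. 3.7 (3.64) for `a_KG^η_KQ^*_K`, `A = 0`).**  For `d ≥ 1`, odd `L > 1`, `a > 0`, `m² ≥ 0`
there are `δ₀, c₀ > 0` (functions of `d, L, a, m²` only) such that for EVERY volume `(d, L, m, K)` with `K ≥ 1`, the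
unit torus `M_μ = 2L^m` of that volume, every spelling `N = L^K` of the fine torus `Tor (fine N M)`, EVERY fine point `x`
and EVERY unit site `b`:  `|ℋ_K(x, b)| ≤ a_K·c₀·exp(−δ₀·tdistT M (B(x)) b)`, `B(x) = blockOf N M x` the unit site under
`x`, `ℋ_K = minimiser N M a_K N² m²` the ACTUAL operator of `EffectiveLaplacianSymbol`, `a_K = aK a L K`.  Input:
`minimiser_kernel_decay_labels` (= [Ba 4] (1.10) via `thm110_zero_torus`) at `D := max 0 ((|B(x) − b| − 2)∕ε)`, sound
by `T_blk_le_eps_mul`; the slack costs the factor `e^{2δ₀}` in `c₀`.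
[cite: King1986, Theorem 3.3 (3.7) p.658, Prop. 3.7 (3.64) p.663; Balaban1983RegularityDecay, Theorem (1.10) p.573] -/
theorem minimiser_kernel_decay_blocks (dd L : ℕ) (hd : 1 ≤ dd) (hL : Odd L ∧ 1 < L) {a : ℝ} (ha : 0 < a)
    {msq : ℝ} (hmsq : 0 ≤ msq) :
    ∃ δ₀ c₀ : ℝ, 0 < δ₀ ∧ 0 < c₀ ∧ ∀ (P : Params), P.d = dd → P.L = L → 1 ≤ P.K →
      ∀ (M : Fin P.d → ℕ) [∀ μ, NeZero (M μ)] (_hMK : ∀ μ, M μ = P.sitesPerDir P.K)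
        (N : ℕ) [NeZero N] (_hN : N = P.L ^ P.K) (xt : Tor (fine N M)) (bt : Tor M),
        |minimiser N M (aK a P.L P.K) (((N : ℕ) : ℝ) ^ 2) msq (Pi.single bt 1) xt|
          ≤ aK a P.L P.K * c₀ * Real.exp (-(δ₀ * tdistT M (blockOf N M xt) bt)) := by
  obtain ⟨δ₀, c₀, hδ₀, hc₀, H⟩ := minimiser_kernel_decay_labels dd L hd hL ha hmsq
  refine ⟨δ₀, c₀ * Real.exp (2 * δ₀), hδ₀, by positivity, ?_⟩
  intro P hPd hPL hK M _ hMK N _ hN xt bt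
  subst hN
  have hLr : (1 : ℝ) < P.L := by exact_mod_cast P.hL.2
  have haK : 0 ≤ aK a P.L P.K := (aK_pos ha hLr hK).le
  -- preimages of the King-side points under the dictionaries
  set x : Balaban1983to89.Site P 0 := (torEquiv P M hMK).symm xt with hxdef
  set b : Balaban1983to89.Site P P.K := (torUnitEquiv P M hMK).symm bt with hbdef
  have hxt : toTor P M hMK x = xt := (torEquiv P M hMK).apply_symm_apply xt
  have hbt : toTorUnit P M hMK b = bt := (torUnitEquiv P M hMK).apply_symm_apply bt
  have hx : ∀ μ, (xt μ).val = (x μ).val := fun μ => by rw [← hxt, val_toTor]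
  have hb : ∀ μ, (bt μ).val = (b μ).val := fun μ => by rw [← hbt, val_toTorUnit]
  -- the slack distance fed to Theorem 3.3
  have hε : 0 < P.eps := Params.eps_pos P
  set TK : ℝ := T P P.K (blk P P.K x) b with hTKdef
  set D : ℝ := max 0 ((TK - 2) / P.eps) with hDdef
  have hD0 : 0 ≤ D := le_max_left _ _
  have hDle : ∀ z : Balaban1983to89.Site P 0, Balaban1983to89.Site.proj P.K P.K z = b → D ≤ T P 0 x z := by
    intro z hz
    rcases le_total ((TK - 2) / P.eps) 0 with h | h
    · rw [hDdef, max_eq_left h]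
      exact Balaban1983to89.B5Ineq137Torus.T_nonneg P 0 x z
    · rw [hDdef, max_eq_right h, div_le_iff₀ hε]
      have hdom := T_blk_le_eps_mul P x z
      rw [blk_eq_proj P z, hz] at hdom
      linarith [mul_comm P.eps (T P 0 x z)]
  have hεD : TK - 2 ≤ P.eps * D := by
    have h1 : P.eps * ((TK - 2) / P.eps) ≤ P.eps * D :=
      mul_le_mul_of_nonneg_left (le_max_right _ _) hε.le
    rwa [mul_div_cancel₀ _ hε.ne'] at h1
  have hmain := H P hPd hPL hK M hMK (P.L ^ P.K) rfl xt x hx bt b hb D hD0 hDle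
  have hexp : Real.exp (-(δ₀ * (P.eps * D))) ≤ Real.exp (2 * δ₀) * Real.exp (-(δ₀ * TK)) := by
    rw [← Real.exp_add]
    apply Real.exp_le_exp.mpr
    nlinarith [mul_le_mul_of_nonneg_left hεD hδ₀.le]
  have hTKeq : tdistT M (blockOf (P.L ^ P.K) M xt) bt = TK := by
    rw [← hxt, ← hbt, tdistT_blockOf_toTor]
  rw [hTKeq]
  calc |minimiser (P.L ^ P.K) M (aK a P.L P.K) ((((P.L ^ P.K : ℕ) : ℝ)) ^ 2) msq (Pi.single bt 1) xt|
      ≤ aK a P.L P.K * c₀ * Real.exp (-(δ₀ * (P.eps * D))) := hmain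
    _ ≤ aK a P.L P.K * c₀ * (Real.exp (2 * δ₀) * Real.exp (-(δ₀ * TK))) :=
        mul_le_mul_of_nonneg_left hexp (mul_nonneg haK hc₀.le)
    _ = aK a P.L P.K * (c₀ * Real.exp (2 * δ₀)) * Real.exp (-(δ₀ * TK)) := by ring

/-! ## §4 (3.71), first line, in King's block-distance currency -/

/-- Over a fine point `x′ ∈ T_{η′}` and the point `x ∈ T_η` under it lies the SAME unit block: `B(x′) = B(x)`
(`⌊⌊x′∕L^n⌋∕L^K⌋ = ⌊x′∕(L^nL^K)⌋`). [cite: King1986, p.664 («x′ ∈ B^n(x)»)] -/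
theorem blockOf_over {L K n : ℕ} [NeZero L] (M : Fin d → ℕ) [∀ μ, NeZero (M μ)]
    (xt : Tor (fine (L ^ K) M)) (xt' : Tor (fine (L ^ n * L ^ K) M))
    (hxx : ∀ μ, (xt μ).val = (xt' μ).val / L ^ n) :
    blockOf (L ^ n * L ^ K) M xt' = blockOf (L ^ K) M xt := by
  funext μ
  apply ZMod.val_injective
  rw [val_blockOf, val_blockOf, hxx μ, Nat.div_div_eq_div_mul]

/-- **KING'S (3.71), FIRST LINE, IN KING'S BLOCK-DISTANCE CURRENCY — UNCONDITIONAL.**  For `d ≥ 1`, odd `L ≥ 2`,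
`a > 0`, `m² > 0`, `0 ≤ γ ≤ 1` there are `δ₀, c₀ > 0` (functions of `d, L, a, m²` only) such that for every volume
`P = (d, L, m, K)` with `K ≥ 1`, every `n ≥ 1`, the unit torus `M_μ = 2L^m`, King's ACTUAL minimiser kernels `ℋ_K` on
`Tor (fine L^K M)` and `ℋ_{K+n}` on `Tor (fine (L^nL^K) M)` (`a_K = aK a L K`, `c = η⁻²`), EVERY unit site `b` and fine
points `x′` over `x`:
`|ℋ_{K+n}(x′, b) − ℋ_K(x, b)| ≤ √(2ac₀(C₁ + C₂)·L^{−γK})·e^{−(δ₀∕2)·tdistT M (B(x)) b}` — King's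
`CL^{−γ′k}exp[−δ₀′ dist(B(x), z)]`, with `C₁ = prop38RateConst a a θ (π²∕4)^d d γ`, `C₂ = prop38PosConst a (π²∕4)^d d γ`,
`θ = lemma43Const a L K n`.  Inputs: §3 for both runs (`blockOf_over`: the two runs see the same block), `aK_le`, and
the interpolation `king_prop38_torus_of_decay` («combining our bounds with Theorem 3.3», p.674).
[cite: King1986, Prop. 3.8 (3.71) p.664, p.674] -/
theorem king_prop38_torus_blocks (dd L : ℕ) (hd : 1 ≤ dd) (hLodd : Odd L) (hL : 2 ≤ L) {a m2 : ℝ} (ha : 0 < a)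
    (hm : 0 < m2) {γ : ℝ} (hγ0 : 0 ≤ γ) (hγ1 : γ ≤ 1) :
    ∃ δ₀ c₀ : ℝ, 0 < δ₀ ∧ 0 < c₀ ∧ ∀ (P : Params) (_hPd : P.d = dd) (_hPL : P.L = L) (_hK : 1 ≤ P.K) [NeZero P.L]
      (n : ℕ) (_hn : 1 ≤ n) (M : Fin P.d → ℕ) [∀ μ, NeZero (M μ)] (_hMK : ∀ μ, M μ = P.sitesPerDir P.K)
      (xt : Tor (fine (P.L ^ P.K) M)) (xt' : Tor (fine (P.L ^ n * P.L ^ P.K) M)) (bt : Tor M)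
      (_hxx : ∀ μ, (xt μ).val = (xt' μ).val / P.L ^ n),
      |minimiser (P.L ^ n * P.L ^ P.K) M (aK a P.L (P.K + n)) (((P.L ^ n * P.L ^ P.K : ℕ) : ℝ) ^ 2) m2
            (Pi.single bt 1) xt'
          - minimiser (P.L ^ P.K) M (aK a P.L P.K) (((P.L ^ P.K : ℕ) : ℝ) ^ 2) m2 (Pi.single bt 1) xt|
        ≤ Real.sqrt (((prop38RateConst a a (lemma43Const a P.L P.K n) ((π ^ 2 / 4) ^ P.d) P.d γ
                + prop38PosConst a ((π ^ 2 / 4) ^ P.d) P.d γ) * ((P.L ^ P.K : ℕ) : ℝ) ^ (-γ)) * (2 * (a * c₀)))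
            * Real.exp (-(δ₀ / 2 * tdistT M (blockOf (P.L ^ P.K) M xt) bt)) := by
  have hL1 : 1 < L := by omega
  obtain ⟨δ₀, c₀, hδ₀, hc₀, H⟩ := minimiser_kernel_decay_blocks dd L hd ⟨hLodd, hL1⟩ ha hm.le
  refine ⟨δ₀, c₀, hδ₀, hc₀, ?_⟩
  intro P hPd hPL hK _ n hn M _ hMK xt xt' bt hxx
  have hLr : (1 : ℝ) < P.L := by exact_mod_cast P.hL.2
  have hPd0 : 0 < P.d := by have := P.hd; omega
  have hPodd : Odd P.L := P.hL.1
  have hPL2 : 2 ≤ P.L := by have := P.hL.2; omega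
  -- run A: volume `P`
  have hA := H P hPd hPL hK M hMK (P.L ^ P.K) rfl xt bt
  have hdecA : |minimiser (P.L ^ P.K) M (aK a P.L P.K) (((P.L ^ P.K : ℕ) : ℝ) ^ 2) m2 (Pi.single bt 1) xt|
      ≤ a * c₀ * Real.exp (-(δ₀ * tdistT M (blockOf (P.L ^ P.K) M xt) bt)) :=
    hA.trans (mul_le_mul_of_nonneg_right (mul_le_mul_of_nonneg_right (aK_le ha hLr hK) hc₀.le)
      (Real.exp_pos _).le)
  -- run B: volume `(d, L, m, K + n)` over the same unit torus
  have hMK' : ∀ μ, M μ = (⟨P.d, P.L, P.m, P.K + n, P.hd, P.hL⟩ : Params).sitesPerDir (P.K + n) := fun μ => by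
    rw [hMK μ]; exact (sitesPerDir_finerVolume P n).symm
  have hN : P.L ^ n * P.L ^ P.K = P.L ^ (P.K + n) := by rw [pow_add, mul_comm]
  have hB := H (⟨P.d, P.L, P.m, P.K + n, P.hd, P.hL⟩ : Params) hPd hPL (show 1 ≤ P.K + n by omega) M hMK'
    (P.L ^ n * P.L ^ P.K) hN xt' bt
  rw [blockOf_over M xt xt' hxx] at hB
  have hdecB : |minimiser (P.L ^ n * P.L ^ P.K) M (aK a P.L (P.K + n)) (((P.L ^ n * P.L ^ P.K : ℕ) : ℝ) ^ 2) m2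
        (Pi.single bt 1) xt'| ≤ a * c₀ * Real.exp (-(δ₀ * tdistT M (blockOf (P.L ^ P.K) M xt) bt)) :=
    hB.trans (mul_le_mul_of_nonneg_right (mul_le_mul_of_nonneg_right
      (aK_le ha hLr (show 1 ≤ P.K + n by omega)) hc₀.le) (Real.exp_pos _).le)
  exact king_prop38_torus_of_decay hPd0 hPodd hPL2 hK hn M ha hm hγ0 hγ1 bt xt xt' hxx hdecA hdecB

/-! ## §5 The consumers' read-out shapes: rows at any common rate `κ ≤ δ₀∕2`, columns by symmetry -/

/-- Weakening both §3 and §4 to a common smaller rate `κ` (the (3.73) knit reads all four outer lines at one `κ`):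
for `0 < κ ≤ δ₀∕2`, `|ℋ_K(x, b)| ≤ a·c₀·e^{−κ·tdistT M (B(x)) b}` (`a_K ≤ a`). [cite: King1986, Prop. 3.7 (3.64) p.663] -/
theorem minimiser_row_decay (dd L : ℕ) (hd : 1 ≤ dd) (hL : Odd L ∧ 1 < L) {a : ℝ} (ha : 0 < a)
    {msq : ℝ} (hmsq : 0 ≤ msq) :
    ∃ δ₀ c₀ : ℝ, 0 < δ₀ ∧ 0 < c₀ ∧ ∀ (P : Params), P.d = dd → P.L = L → 1 ≤ P.K →
      ∀ (M : Fin P.d → ℕ) [∀ μ, NeZero (M μ)] (_hMK : ∀ μ, M μ = P.sitesPerDir P.K)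
        (N : ℕ) [NeZero N] (_hN : N = P.L ^ P.K) (κ : ℝ), 0 < κ → κ ≤ δ₀ →
        ∀ (xt : Tor (fine N M)) (bt : Tor M),
        |minimiser N M (aK a P.L P.K) (((N : ℕ) : ℝ) ^ 2) msq (Pi.single bt 1) xt|
          ≤ a * c₀ * Real.exp (-(κ * tdistT M (blockOf N M xt) bt)) := by
  obtain ⟨δ₀, c₀, hδ₀, hc₀, H⟩ := minimiser_kernel_decay_blocks dd L hd hL ha hmsq
  refine ⟨δ₀, c₀, hδ₀, hc₀, ?_⟩
  intro P hPd hPL hK M _ hMK N _ hN κ _ hκδ xt bt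
  have hLr : (1 : ℝ) < P.L := by exact_mod_cast P.hL.2
  have h1 := H P hPd hPL hK M hMK N hN xt bt
  have h2 : aK a P.L P.K * c₀ * Real.exp (-(δ₀ * tdistT M (blockOf N M xt) bt))
      ≤ a * c₀ * Real.exp (-(δ₀ * tdistT M (blockOf N M xt) bt)) :=
    mul_le_mul_of_nonneg_right (mul_le_mul_of_nonneg_right (aK_le ha hLr hK) hc₀.le) (Real.exp_pos _).le
  exact (h1.trans h2).trans
    (exp_decay_mono (mul_nonneg ha.le hc₀.le) hκδ (tdistT_nonneg M _ _))

/-- The column form of §3 (`tdistT` is symmetric): `|ℋ_K(x, b)| ≤ a·c₀·e^{−κ·tdistT M b (B(x))}` — the shape of the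
right-hand outer line `a_kQ_kG^η_k(·, x)` of (3.73). [cite: King1986, Prop. 3.9 (3.73) p.665] -/
theorem minimiser_col_decay (dd L : ℕ) (hd : 1 ≤ dd) (hL : Odd L ∧ 1 < L) {a : ℝ} (ha : 0 < a)
    {msq : ℝ} (hmsq : 0 ≤ msq) :
    ∃ δ₀ c₀ : ℝ, 0 < δ₀ ∧ 0 < c₀ ∧ ∀ (P : Params), P.d = dd → P.L = L → 1 ≤ P.K →
      ∀ (M : Fin P.d → ℕ) [∀ μ, NeZero (M μ)] (_hMK : ∀ μ, M μ = P.sitesPerDir P.K)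
        (N : ℕ) [NeZero N] (_hN : N = P.L ^ P.K) (κ : ℝ), 0 < κ → κ ≤ δ₀ →
        ∀ (xt : Tor (fine N M)) (bt : Tor M),
        |minimiser N M (aK a P.L P.K) (((N : ℕ) : ℝ) ^ 2) msq (Pi.single bt 1) xt|
          ≤ a * c₀ * Real.exp (-(κ * tdistT M bt (blockOf N M xt))) := by
  obtain ⟨δ₀, c₀, hδ₀, hc₀, H⟩ := minimiser_row_decay dd L hd hL ha hmsq
  refine ⟨δ₀, c₀, hδ₀, hc₀, ?_⟩
  intro P hPd hPL hK M _ hMK N _ hN κ hκ hκδ xt bt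
  rw [tdistT_symm M bt]
  exact H P hPd hPL hK M hMK N hN κ hκ hκδ xt bt

/-- Weakening §4 to a smaller rate: for `0 < κ ≤ δ₀∕2`,
`|ℋ_{K+n}(x′, b) − ℋ_K(x, b)| ≤ √(2ac₀(C₁ + C₂)L^{−γK})·e^{−κ·tdistT M (B(x)) b}`. [cite: King1986, Prop. 3.8 (3.71) p.664] -/
theorem minimiser_row_rate (dd L : ℕ) (hd : 1 ≤ dd) (hLodd : Odd L) (hL : 2 ≤ L) {a m2 : ℝ} (ha : 0 < a)
    (hm : 0 < m2) {γ : ℝ} (hγ0 : 0 ≤ γ) (hγ1 : γ ≤ 1) :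
    ∃ δ₀ c₀ : ℝ, 0 < δ₀ ∧ 0 < c₀ ∧ ∀ (P : Params) (_hPd : P.d = dd) (_hPL : P.L = L) (_hK : 1 ≤ P.K) [NeZero P.L]
      (n : ℕ) (_hn : 1 ≤ n) (M : Fin P.d → ℕ) [∀ μ, NeZero (M μ)] (_hMK : ∀ μ, M μ = P.sitesPerDir P.K)
      (κ : ℝ) (_hκ : 0 < κ) (_hκδ : κ ≤ δ₀ / 2)
      (xt : Tor (fine (P.L ^ P.K) M)) (xt' : Tor (fine (P.L ^ n * P.L ^ P.K) M)) (bt : Tor M)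
      (_hxx : ∀ μ, (xt μ).val = (xt' μ).val / P.L ^ n),
      |minimiser (P.L ^ n * P.L ^ P.K) M (aK a P.L (P.K + n)) (((P.L ^ n * P.L ^ P.K : ℕ) : ℝ) ^ 2) m2
            (Pi.single bt 1) xt'
          - minimiser (P.L ^ P.K) M (aK a P.L P.K) (((P.L ^ P.K : ℕ) : ℝ) ^ 2) m2 (Pi.single bt 1) xt|
        ≤ Real.sqrt (((prop38RateConst a a (lemma43Const a P.L P.K n) ((π ^ 2 / 4) ^ P.d) P.d γ
                + prop38PosConst a ((π ^ 2 / 4) ^ P.d) P.d γ) * ((P.L ^ P.K : ℕ) : ℝ) ^ (-γ)) * (2 * (a * c₀)))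
            * Real.exp (-(κ * tdistT M (blockOf (P.L ^ P.K) M xt) bt)) := by
  obtain ⟨δ₀, c₀, hδ₀, hc₀, H⟩ := king_prop38_torus_blocks dd L hd hLodd hL ha hm hγ0 hγ1
  refine ⟨δ₀, c₀, hδ₀, hc₀, ?_⟩
  intro P hPd hPL hK _ n hn M _ hMK κ _ hκδ xt xt' bt hxx
  exact (H P hPd hPL hK n hn M hMK xt xt' bt hxx).trans
    (exp_decay_mono (Real.sqrt_nonneg _) hκδ (tdistT_nonneg M _ _))

end Torus

end Literature.MathematicalPhysics.QuantumFieldTheory.King1986
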